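import Mathlib
import HarnessLib
import Summits.HubbardSuperconductivity.HubbardSuperconductivity.Theorems.LiebTwinNoOnsiteODLROWeakCouplingPairWindow
import Literature.MathematicalPhysics.QuantumLattice.TorusBandParticleHole

/-!
# Crux `NoOnsiteODLRO` (stmt-HubbardSuperconductivity-0933): the strict pair window at WEAK coupling,
# every doping `δ ∈ (0, 1/2)`

Repulsive Hubbard model `H = hubbardTorus 2 L 1 U = T + U·D` on the even torus `(ℤ/Lℤ)²`; `E(a,b)` the bottom of
Lieb's sector `(N↑, N↓) = (a, b)`. The companion file `LiebTwinNoOnsiteODLROWeakCouplingPairWindow` proves the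
strict window `U - (E(N,0) - E(N-2,0)) ≥ κ > 0` at weak coupling for the dopings `δ ∈ [1/10, 2/5]`, with a FIXED
Pauli room `L²/256` below the fixed energy `-4 sin²(π/50)`. Here the two inputs are made parametric in `δ`:

* `minEnergyOn_addOne_le_room` — one Bloch addition `c†_{kσ}` costs at most `μ + U/β` in sector energy as soon
  as `#{k : ε_L(k) ≤ μ} ≥ n_σ + β²L²` (pigeonhole over the modes below `μ` + `momentum_addition_step`);
* the level count below `μ = -(δ/2)²` on the EVEN torus is `≥ L²/2 - δL²/4 - L` by particle–hole symmetry and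
  the uniform van Hove shell count (`sub_le_two_mul_card_filter_torusBand_le_neg`, no Weyl law needed), which
  exceeds the `⌊(1-δ)L²/2⌋ - 1 ≤ L²/2 - δL²/2 - 1` electrons per spin by more than `(δ/4)²L²` once `δL ≥ 5`.

Two additions `(m,m) → (m+1,m) → (m+1,m+1)` then give `E(N,0) ≤ E(N-2,0) - δ²/2 + 8U/δ`, whence the window
`≥ δ²/4 =: κ` for `0 ≤ U ≤ U₁ := δ³/32` (registered stub `stub_weakCouplingPairWindowAllDoping`).
Yang, PRL 63 (1989) 2144; Lieb, PRL 62 (1989) 1201 (particle–hole symmetry of the bipartite band);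
Tasaki (2020) §2.1. Folklore bookkeeping; no definitions.
-/
noncomputable section

namespace Summit.HubbardSuperconductivity.NoOnsiteODLRO.WeakCoupling

open Matrix Finset Filter
open scoped ComplexOrder
open Literature.Probability.LatticeModels Literature.MathematicalPhysics.QuantumLattice
open Summit.HubbardSuperconductivity.HubbardSuperconductivity.Theorems.EnslavedA1g

section Room

variable (L : ℕ) [NeZero L]

/-- **One Bloch addition costs at most `μ + U/β` in sector energy** when the level count below `μ` leaves the
Pauli room `β²L²`: if `#{k : ε_L(k) ≤ μ} ≥ n_σ + β²L²` (`n_↑ = a`, `n_↓ = b`), `a, b ≤ L²`, `L ≥ 3`, `U ≥ 0`,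
`β > 0`, then `E(a', b') ≤ E(a, b) + μ + U/β` for `(a', b') = (a+1, b)` (`σ = ↑`) resp. `(a, b+1)` (`σ = ↓`),
`E(a,b)` the bottom of `szSector (a+b) ((a-b)/2)` for `hubbardTorus 2 L 1 U`: by pigeonhole some mode `k` below
`μ` has `‖c†_{kσ}φ‖² ≥ β²‖φ‖²` on a ground state `φ` of `(a, b)` (`sum_re_inner_momentumCreation_mulVec_ge`,
`#{ε ≤ μ} ≤ L²`), and `momentum_addition_step` applies (parametric form of `minEnergyOn_addOne_le_weak`).
Tasaki (2020) §2.1; Yang, PRL 63 (1989) 2144. [folklore] -/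
theorem minEnergyOn_addOne_le_room (hL : 3 ≤ L) {U : ℝ} (hU : 0 ≤ U) (σ : Fin 2) {a b : ℕ} (ha : a ≤ L ^ 2)
    (hb : b ≤ L ^ 2) (μ : ℝ) {β : ℝ} (hβ : 0 < β)
    (hroom : ((if σ = 0 then a else b : ℕ) : ℝ) + β ^ 2 * (L : ℝ) ^ 2 ≤ torusLevelCount L μ) :
    (hubbardTorus 2 L 1 U).minEnergyOn (szSector ((if σ = 0 then a + 1 else a) + (if σ = 0 then b else b + 1))
          ((((if σ = 0 then a + 1 else a : ℕ) : ℝ) - (if σ = 0 then b else b + 1 : ℕ)) / 2)) ≤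
      (hubbardTorus 2 L 1 U).minEnergyOn (szSector (a + b) (((a : ℝ) - b) / 2)) + μ + U / β := by
  set a' : ℕ := if σ = 0 then a + 1 else a
  set b' : ℕ := if σ = 0 then b else b + 1
  set nσ : ℕ := if σ = 0 then a else b
  set H := hubbardTorus 2 L 1 U
  -- a ground state of the lower sector, and the variational principle on the upper one
  obtain ⟨φ, hφ, hφ0, hHφ'⟩ := (upDownSector_groundState (fermionTorusGraph 2 L) 1 U (a := a) (b := b)
    (by rw [card_fermionTorus]; exact ha) (by rw [card_fermionTorus]; exact hb)).1
  have hHφ : H *ᵥ φ = ((H.minEnergyOn (szSector (a + b) (((a : ℝ) - b) / 2)) : ℝ) : ℂ) • φ := hHφ'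
  have hEw : ∀ w : Fock (Orb (FermionTorus 2 L)), IsInSector a' b' w →
      H.minEnergyOn (szSector (a' + b') (((a' : ℝ) - b') / 2)) * (star w ⬝ᵥ w).re ≤ (star w ⬝ᵥ (H *ᵥ w)).re :=
    fun w hw => UpperSandwich.minEnergyOn_mul_le_re (LiebThm1.hamiltonian_isHermitian (fermionTorusGraph 2 L) 1 U) _
      ((Summit.HubbardSuperconductivity.HubbardSuperconductivity.Theorems.isInSector_iff_mem_szSector a' b' w).1 hw)
  -- the modes below `μ`: `|S| = torusLevelCount L μ ∈ [nσ + β²L², L²]`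
  set S : Finset (TorusSite 2 L) := Finset.univ.filter fun k => torusBand L k ≤ μ
  have hSle : (S.card : ℝ) ≤ (L : ℝ) ^ 2 := by exact_mod_cast torusLevelCount_le (L := L) μ
  have hroom' : (nσ : ℝ) + β ^ 2 * (L : ℝ) ^ 2 ≤ S.card := hroom
  have hL3 : (3 : ℝ) ≤ L := by exact_mod_cast hL
  have hβL : 0 < β ^ 2 * (L : ℝ) ^ 2 := by positivity
  have hSpos : (0 : ℝ) < S.card := by have h0 : (0 : ℝ) ≤ nσ := Nat.cast_nonneg nσ; linarith
  -- pigeonhole: a mode `k` below `μ` with `‖c†_{kσ}φ‖² ≥ (|S| - nσ)/|S| · ‖φ‖² ≥ β²‖φ‖²`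
  obtain ⟨k, hkS, hk⟩ := Finset.exists_le_of_sum_le (Finset.card_pos.1 (by exact_mod_cast hSpos))
    (f := fun _ => ((S.card : ℝ) - nσ) * (star φ ⬝ᵥ φ).re / S.card)
    (g := fun k => (star (momentumCreation k σ *ᵥ φ) ⬝ᵥ (momentumCreation k σ *ᵥ φ)).re)
    (by rw [Finset.sum_const, nsmul_eq_mul, mul_div_cancel₀ _ hSpos.ne']; exact sum_re_inner_momentumCreation_mulVec_ge hφ σ S)
  have hroomk : β ^ 2 * (star φ ⬝ᵥ φ).re ≤
      (star (momentumCreation k σ *ᵥ φ) ⬝ᵥ (momentumCreation k σ *ᵥ φ)).re := by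
    refine le_trans ?_ hk
    rw [mul_div_right_comm]
    refine mul_le_mul_of_nonneg_right ?_ (Complex.pos_iff.mp (dotProduct_star_self_pos_iff.2 hφ0)).1.le
    rw [le_div_iff₀ hSpos]
    nlinarith [mul_le_mul_of_nonneg_left hSle (sq_nonneg β)]
  obtain ⟨τ', hne⟩ : ∃ τ' : Fin 2, τ' ≠ σ := ⟨σ + 1, by fin_cases σ <;> decide⟩
  have hstep := momentum_addition_step hL hU hne k hφ0 hHφ (isInSector_momentumCreation_mulVec hφ k σ) hEw hβ hroomk
  have hεk : torusBand L k ≤ μ := (Finset.mem_filter.1 hkS).2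
  linarith

/-- **Level count below `-(s)²` on the even torus**: for even `L` and `0 ≤ s`,
`L²/2 - s·L²/2 - L ≤ #{k : ε_L(k) ≤ -s²}` (particle–hole symmetry `ε_{k+Q} = -ε_k` plus the uniform shell count
`#{|ε| ≤ s²} ≤ s L² + 2L` at the van Hove level; `sub_le_two_mul_card_filter_torusBand_le_neg`). Lieb, PRL 62 (1989)
1201. [folklore] -/
theorem half_sub_le_torusLevelCount_neg_sq (hLe : Even L) {s : ℝ} (hs : 0 ≤ s) :
    (L : ℝ) ^ 2 / 2 - s * (L : ℝ) ^ 2 / 2 - L ≤ torusLevelCount L (-(s ^ 2)) := by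
  have h := sub_le_two_mul_card_filter_torusBand_le_neg (L := L) hLe (sq_nonneg s)
  rw [Real.sqrt_sq hs, ← torusLevelCount_def] at h
  linarith

end Room

/-- **Registered stub `stub_weakCouplingPairWindowAllDoping`** of crux `NoOnsiteODLRO` (stmt-HubbardSuperconductivity-0933;
a helper of line `registered`): **the pair chemical-potential window is STRICT at weak coupling for EVERY doping
`δ ∈ (0, 1/2)`.** There are `U₁ > 0`, `κ > 0` (namely `κ = δ²/4`, `U₁ = δ³/32`) and `L₀` (`= ⌈5/δ⌉ + 3`) with
`U - (E(N,0) - E(N-2,0)) ≥ κ` for all `0 ≤ U ≤ U₁`, even `L ≥ L₀`, `N = 2⌊(1-δ)L²/2⌋ = 2m + 2`,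
`H = hubbardTorus 2 L 1 U`: below `μ = -(δ/2)²` the even torus has `≥ L²/2 - δL²/4 - L` Bloch levels
(`half_sub_le_torusLevelCount_neg_sq`) against at most `m ≤ L²/2 - δL²/2 - 1` electrons per spin, leaving the
Pauli room `(δ/4)²L²`, so two Bloch additions `(m,m) → (m+1,m) → (m+1,m+1)` below `μ`
(`minEnergyOn_addOne_le_room` with `β = δ/4`) give `E(N,0) ≤ E(N-2,0) - δ²/2 + 8U/δ ≤ E(N-2,0) - δ²/4`.
Yang, PRL 63 (1989) 2144; Lieb, PRL 62 (1989) 1201; Tasaki (2020) §2.1. [folklore] -/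
theorem stub_weakCouplingPairWindowAllDoping : ∀ δ : ℝ, δ ∈ Set.Ioo (0 : ℝ) (1 / 2) → ∃ U₁ : ℝ, 0 < U₁ ∧ ∃ κ : ℝ, 0 < κ ∧ ∃ L₀ : ℕ, ∀ (U : ℝ), 0 ≤ U → U ≤ U₁ → ∀ (L : ℕ) [NeZero L], Even L → L₀ ≤ L → κ ≤ U - ((hubbardTorus 2 L 1 U).minEnergyOn (szSector (Λ := FermionTorus 2 L) (2 * ⌊(1 - δ) * (L : ℝ) ^ 2 / 2⌋₊) 0) - (hubbardTorus 2 L 1 U).minEnergyOn (szSector (Λ := FermionTorus 2 L) (2 * ⌊(1 - δ) * (L : ℝ) ^ 2 / 2⌋₊ - 2) 0)) := by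
  intro δ hδ
  obtain ⟨hδ0, hδ1⟩ := hδ
  refine ⟨δ ^ 3 / 32, by positivity, δ ^ 2 / 4, by positivity, ⌈5 / δ⌉₊ + 3, fun U hU0 hU1 L _ hLe hL => ?_⟩
  have hL3 : 3 ≤ L := le_trans (Nat.le_add_left 3 _) hL
  have hL3r : (3 : ℝ) ≤ (L : ℝ) := by exact_mod_cast hL3
  have hL5 : 5 / δ ≤ (L : ℝ) :=
    (Nat.le_ceil (5 / δ)).trans (by exact_mod_cast le_trans (Nat.le_add_right _ 3) hL)
  have hLδ : 5 ≤ δ * L := by rw [div_le_iff₀ hδ0] at hL5; linarith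
  -- the level count below `μ = -(δ/2)²`
  set μ : ℝ := -((δ / 2) ^ 2) with hμ
  have hμ' : μ = -(δ ^ 2 / 4) := by rw [hμ]; ring
  have hcount : (L : ℝ) ^ 2 / 2 - δ / 2 * (L : ℝ) ^ 2 / 2 - L ≤ torusLevelCount L μ :=
    half_sub_le_torusLevelCount_neg_sq L hLe (by positivity)
  -- `N = 2(kk-1) + 2`, `kk = ⌊(1-δ)L²/2⌋ ≥ 1`, `kk - 1 ≤ L²/2 - δL²/2 - 1`
  set kk : ℕ := ⌊(1 - δ) * (L : ℝ) ^ 2 / 2⌋₊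
  have hk1 : 1 ≤ kk := by
    refine Nat.le_floor ?_
    rw [Nat.cast_one, le_div_iff₀ (by norm_num : (0 : ℝ) < 2)]
    nlinarith
  have hfl : (kk : ℝ) ≤ (1 - δ) * (L : ℝ) ^ 2 / 2 := Nat.floor_le (by nlinarith)
  rw [show 2 * kk - 2 = 2 * (kk - 1) by omega, show 2 * kk = 2 * (kk - 1) + 2 by omega]
  have hkR : ((kk - 1 : ℕ) : ℝ) = (kk : ℝ) - 1 := by rw [Nat.cast_sub hk1, Nat.cast_one]
  have hm : kk ≤ L ^ 2 := by
    exact_mod_cast (show (kk : ℝ) ≤ (L : ℝ) ^ 2 by nlinarith)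
  -- the Pauli room `(δ/4)² L²` below `μ`
  have hroom : ((kk - 1 : ℕ) : ℝ) + (δ / 4) ^ 2 * (L : ℝ) ^ 2 ≤ torusLevelCount L μ := by
    rw [hkR]
    have h1 : δ ^ 2 * (L : ℝ) ^ 2 ≤ δ * (L : ℝ) ^ 2 / 2 := by
      nlinarith [mul_le_mul_of_nonneg_right hδ1.le (by positivity : (0 : ℝ) ≤ δ * (L : ℝ) ^ 2)]
    have h2 : (L : ℝ) ≤ δ * (L : ℝ) ^ 2 / 5 := by
      nlinarith [mul_le_mul_of_nonneg_right hLδ (Nat.cast_nonneg L)]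
    nlinarith
  have hβ : (0 : ℝ) < δ / 4 := by positivity
  have h1 := minEnergyOn_addOne_le_room L hL3 hU0 0 (a := kk - 1) (b := kk - 1) (by omega) (by omega) μ hβ
    (by rw [if_pos rfl]; exact hroom)
  have h2 := minEnergyOn_addOne_le_room L hL3 hU0 1 (a := kk - 1 + 1) (b := kk - 1) (by omega) (by omega) μ hβ
    (by rw [if_neg one_ne_zero]; exact hroom)
  simp only [if_true, one_ne_zero, if_false] at h1 h2
  have e0 : szSector (Λ := FermionTorus 2 L) (kk - 1 + (kk - 1)) ((((kk - 1 : ℕ) : ℝ) - ((kk - 1 : ℕ) : ℝ)) / 2) =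
      szSector (2 * (kk - 1)) 0 := by congr 1 <;> ring
  have e1 : szSector (Λ := FermionTorus 2 L) (kk - 1 + 1 + (kk - 1)) ((((kk - 1 + 1 : ℕ) : ℝ) - ((kk - 1 : ℕ) : ℝ)) / 2) =
      szSector (kk - 1 + 1 + (kk - 1)) (1 / 2) := by congr 1; push_cast; ring
  have e2 : szSector (Λ := FermionTorus 2 L) (kk - 1 + 1 + (kk - 1 + 1))
      ((((kk - 1 + 1 : ℕ) : ℝ) - ((kk - 1 + 1 : ℕ) : ℝ)) / 2) = szSector (2 * (kk - 1) + 2) 0 := by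
    congr 1; ring; rw [sub_self, zero_div]
  rw [e0, e1] at h1; rw [e1, e2] at h2
  -- the coupling budget: `U/(δ/4) ≤ δ²/8` for `U ≤ δ³/32`
  have hU8 : U / (δ / 4) ≤ δ ^ 2 / 8 := by
    rw [div_le_iff₀ hβ]; nlinarith
  linarith

end Summit.HubbardSuperconductivity.NoOnsiteODLRO.WeakCoupling

end
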